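import Mathlib.Topology.OpenPartialHomeomorph.Continuity
import Mathlib.Analysis.SpecialFunctions.Complex.Log
import Mathlib.Analysis.SpecialFunctions.Complex.LogBounds
import Literature.Topology.Euclidean.BrouwerNormedSpace

/-!
# The planar two-level zero lemma
(`BalabanIR.BirComplexStableXY`, stmt-HubbardSuperconductivity-2080, line `theta-rotor-equimodular-zeros`, S3)

Pure analysis — the zero-producing step of the Beraha–Kahane–Weiss mechanism; no lattice content.
Let `e` be a local homeomorphism `ℝ × ℝ → ℂ` whose source contains the closed ball `closedBall p ρ`
(`ρ > 0`, sup metric of `ℝ × ℝ`) with `‖e p‖ = 1`, and let `f M` (`M : ℕ`) be continuous on the ball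
with `f M = 1 + e^M + o(1)` uniformly on the ball as `M → ∞`.  Then `f M` has an exact zero in the
ball for every large `M` (`exists_zero_of_twoLevel`; registered form `stub_twoLevelZeroLemma`).

Proof.  Write `e p = exp (i a)` and, for `M` large and `q` in the ball, `R q := f M q - 1 - (e q)^M`
(`‖R q‖ ≤ 1/2`) and `w q := log (1 + R q)` (`‖w q‖ ≤ 1`).  With `k := round ((M a/π - 1)/2)` the
map `t q := exp (((2k+1)π i + w q)/M)` is continuous on the ball, `(t q)^M = -(1 + R q)`, and
`‖t q - e p‖ ≤ 2(π+1)/M`; so for large `M` it takes values in a closed disc around `e p` contained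
in `e '' (ball p ρ)` (`e` is open).  Hence `Φ := e.symm ∘ t` is a continuous self-map of
`closedBall p ρ`, and Brouwer's fixed point theorem in the finite-dimensional normed space `ℝ × ℝ`
(tree: `Literature.Topology.Euclidean.Brouwer.exists_fixedPoint_closedBall_of_finiteDimensional`)
gives `q` with `e q = t q`, i.e. `(e q)^M = -(1 + R q)`, i.e. `f M q = 0`.
No definitions, no named facts.
-/

namespace Summit.HubbardSuperconductivity.BirComplexStableXYNegative

open scoped Real
open Metric Set Complex

/-- `exp ((2k+1)π i) = -1` for every integer `k`. -/
theorem exp_odd_mul_pi_mul_I (k : ℤ) :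
    Complex.exp ((((2 * (k : ℝ) + 1) * π : ℝ) : ℂ) * I) = -1 := by
  have h : (((2 * (k : ℝ) + 1) * π : ℝ) : ℂ) * I = (k : ℂ) * (2 * π * I) + π * I := by
    push_cast
    ring
  rw [h, Complex.exp_add, Complex.exp_int_mul_two_pi_mul_I, Complex.exp_pi_mul_I, one_mul]

/-- Root selection: with `k = round ((M a/π - 1)/2)` the odd multiple `(2k+1)π/M` of `π/M` is
within `π/M` of `a`. -/
theorem abs_odd_mul_pi_div_sub_le {M : ℕ} (hM : (0 : ℝ) < M) (a : ℝ) :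
    |(2 * ((round (((M : ℝ) * a / π - 1) / 2) : ℤ) : ℝ) + 1) * π / M - a| ≤ π / M := by
  have hπ : (π : ℝ) ≠ 0 := Real.pi_ne_zero
  have hM' : (M : ℝ) ≠ 0 := hM.ne'
  set x : ℝ := ((M : ℝ) * a / π - 1) / 2 with hx
  have hk : |((round x : ℤ) : ℝ) - x| ≤ 1 / 2 := by
    rw [abs_sub_comm]
    exact abs_sub_round x
  have hid : (2 * ((round x : ℤ) : ℝ) + 1) * π / M - a = 2 * π / M * (((round x : ℤ) : ℝ) - x) := by
    rw [hx]
    field_simp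
    ring
  rw [hid, abs_mul, abs_of_pos (by positivity : (0 : ℝ) < 2 * π / M)]
  calc 2 * π / M * |((round x : ℤ) : ℝ) - x| ≤ 2 * π / M * (1 / 2) := by gcongr
    _ = π / M := by ring

/-- `‖log (1 + z)‖ ≤ 1` for `‖z‖ ≤ 1/2`. -/
theorem norm_log_one_add_le_one {z : ℂ} (hz : ‖z‖ ≤ 1 / 2) : ‖Complex.log (1 + z)‖ ≤ 1 :=
  (Complex.norm_log_one_add_half_le_self hz).trans (by linarith)

/-- The selected root is close to `exp (i a)`: if `|θ/M - a| ≤ π/M`, `‖w‖ ≤ 1` and `(π+1)/M ≤ 1`,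
then `‖exp ((θ i + w)/M) - exp (a i)‖ ≤ 2 (π + 1)/M`. -/
theorem norm_exp_div_sub_exp_le {M : ℕ} (hM : (0 : ℝ) < M) {θ a : ℝ} {w : ℂ}
    (hθ : |θ / M - a| ≤ π / M) (hw : ‖w‖ ≤ 1) (hM1 : (π + 1) / M ≤ 1) :
    ‖Complex.exp (((θ : ℂ) * I + w) / (M : ℂ)) - Complex.exp ((a : ℂ) * I)‖
      ≤ 2 * ((π + 1) / M) := by
  have hdiff : ((θ : ℂ) * I + w) / (M : ℂ) - (a : ℂ) * I
      = ((θ / M - a : ℝ) : ℂ) * I + w / (M : ℂ) := by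
    push_cast
    ring
  have hnorm : ‖((θ : ℂ) * I + w) / (M : ℂ) - (a : ℂ) * I‖ ≤ (π + 1) / M := by
    rw [hdiff]
    refine (norm_add_le _ _).trans ?_
    rw [norm_mul, Complex.norm_real, Complex.norm_I, mul_one, norm_div, Complex.norm_natCast,
      Real.norm_eq_abs, add_div]
    have h2 : ‖w‖ / (M : ℝ) ≤ 1 / M := by gcongr
    linarith
  have key : ∀ u v : ℂ, Complex.exp u - Complex.exp v
      = Complex.exp v * (Complex.exp (u - v) - 1) := by
    intro u v
    rw [mul_sub, mul_one, ← Complex.exp_add, add_sub_cancel]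
  rw [key, norm_mul, Complex.norm_exp_ofReal_mul_I, one_mul]
  exact (Complex.norm_exp_sub_one_le (hnorm.trans hM1)).trans (by linarith)

/-- The zero at ONE large level `M`.  If the closed disc `closedBall (e p) η` (`η ≤ 1`) lies in the
image `e '' ball p ρ`, `g` is continuous on `closedBall p ρ` with `‖g - 1 - e^M‖ ≤ 1/2` there, and
`2(π+1)/M ≤ η` (`M > 0`), then `g` has a zero in `closedBall p ρ`: the pull-back by `e.symm` of the
selected `M`-th root of `-(g - e^M)` is a continuous self-map of the ball, and a Brouwer fixed point
of it is a zero of `g`. -/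
theorem exists_zero_of_twoLevel_fixed (e : OpenPartialHomeomorph (ℝ × ℝ) ℂ) (p : ℝ × ℝ) {ρ η : ℝ}
    (g : ℝ × ℝ → ℂ) {M : ℕ} (hρ : 0 ≤ ρ) (hsrc : closedBall p ρ ⊆ e.source) (hnorm : ‖e p‖ = 1)
    (hη1 : η ≤ 1) (hηsub : closedBall (e p) η ⊆ e '' ball p ρ)
    (hg : ContinuousOn g (closedBall p ρ))
    (hgR : ∀ q ∈ closedBall p ρ, ‖g q - 1 - (e q) ^ M‖ ≤ 1 / 2)
    (hMpos : (0 : ℝ) < M) (hMη : 2 * ((π + 1) / M) ≤ η) :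
    ∃ q ∈ closedBall p ρ, g q = 0 := by
  have hM0 : (M : ℂ) ≠ 0 := by exact_mod_cast hMpos.ne'
  have hM1 : (π + 1) / (M : ℝ) ≤ 1 := by
    have h0 : 0 ≤ (π + 1) / (M : ℝ) := by positivity
    linarith
  -- the point `e p = exp (i a)`
  obtain ⟨a, ha⟩ : ∃ a : ℝ, Complex.exp ((a : ℂ) * I) = e p :=
    ⟨Complex.arg (e p), by
      have h := Complex.norm_mul_exp_arg_mul_I (e p)
      rwa [hnorm, Complex.ofReal_one, one_mul] at h⟩
  -- the remainder `R` and the root selection `t`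
  obtain ⟨R, hR⟩ : ∃ R : ℝ × ℝ → ℂ, ∀ q, R q = g q - 1 - (e q) ^ M := ⟨_, fun q => rfl⟩
  have hRle : ∀ q ∈ closedBall p ρ, ‖R q‖ ≤ 1 / 2 := fun q hq => by
    rw [hR]
    exact hgR q hq
  have hslit : ∀ q ∈ closedBall p ρ, 1 + R q ∈ slitPlane := fun q hq =>
    Complex.mem_slitPlane_of_norm_lt_one (by linarith [hRle q hq])
  obtain ⟨k, hk⟩ : ∃ k : ℤ, k = round (((M : ℝ) * a / π - 1) / 2) := ⟨_, rfl⟩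
  have hθa : |(2 * (k : ℝ) + 1) * π / M - a| ≤ π / M := by
    rw [hk]
    exact abs_odd_mul_pi_div_sub_le hMpos a
  obtain ⟨t, ht⟩ : ∃ t : ℝ × ℝ → ℂ, ∀ q, t q =
      Complex.exp (((((2 * (k : ℝ) + 1) * π : ℝ) : ℂ) * I + Complex.log (1 + R q)) / (M : ℂ)) :=
    ⟨_, fun q => rfl⟩
  -- (a) `t q` is an `M`-th root of `-(1 + R q)`
  have hpow : ∀ q ∈ closedBall p ρ, (t q) ^ M = -(1 + R q) := by
    intro q hq
    rw [ht, ← Complex.exp_nat_mul, mul_div_cancel₀ _ hM0, Complex.exp_add,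
      Complex.exp_log (Complex.slitPlane_ne_zero (hslit q hq)), exp_odd_mul_pi_mul_I]
    ring
  -- (b) `t q` is `η`-close to `e p`
  have hclose : ∀ q ∈ closedBall p ρ, t q ∈ closedBall (e p) η := by
    intro q hq
    rw [mem_closedBall, dist_eq_norm, ht, ← ha]
    exact (norm_exp_div_sub_exp_le hMpos hθa (norm_log_one_add_le_one (hRle q hq)) hM1).trans hMη
  -- (c) the pull-back `e.symm ∘ t` is a continuous self-map of the ball
  have htarget : MapsTo t (closedBall p ρ) e.target := by
    intro q hq
    obtain ⟨q', hq', hq'eq⟩ := hηsub (hclose q hq)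
    rw [← hq'eq]
    exact e.map_source (hsrc (ball_subset_closedBall hq'))
  have hmaps : MapsTo (fun q => e.symm (t q)) (closedBall p ρ) (closedBall p ρ) := by
    intro q hq
    obtain ⟨q', hq', hq'eq⟩ := hηsub (hclose q hq)
    show e.symm (t q) ∈ closedBall p ρ
    rw [← hq'eq, e.left_inv (hsrc (ball_subset_closedBall hq'))]
    exact ball_subset_closedBall hq'
  have hRcont : ContinuousOn R (closedBall p ρ) := by
    have hR' : R = fun q => g q - 1 - (e q) ^ M := funext hR
    rw [hR']
    exact (hg.sub continuousOn_const).sub ((e.continuousOn.mono hsrc).pow M)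
  have htcont : ContinuousOn t (closedBall p ρ) := by
    have ht' : t = fun q =>
        Complex.exp (((((2 * (k : ℝ) + 1) * π : ℝ) : ℂ) * I + Complex.log (1 + R q)) / (M : ℂ)) :=
      funext ht
    rw [ht']
    exact ((continuousOn_const.add ((continuousOn_const.add hRcont).clog hslit)).div_const _).cexp
  have hΦcont : ContinuousOn (fun q => e.symm (t q)) (closedBall p ρ) :=
    e.continuousOn_symm.comp htcont htarget
  -- (d) Brouwer's fixed point theorem in `ℝ × ℝ`
  obtain ⟨q, hq, hfix⟩ :=
    Literature.Topology.Euclidean.Brouwer.exists_fixedPoint_closedBall_of_finiteDimensional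
      hρ hΦcont hmaps
  have hfix' : e.symm (t q) = q := hfix
  refine ⟨q, hq, ?_⟩
  have heq : e q = t q := by
    have h := e.right_inv (htarget hq)
    rwa [hfix'] at h
  have hg' : g q = R q + 1 + (e q) ^ M := by
    rw [hR]
    ring
  rw [hg', heq, hpow q hq]
  ring

/-- **Planar two-level zero lemma** (zero-producing step of the Beraha–Kahane–Weiss mechanism).
Let `e` be a local homeomorphism `ℝ × ℝ → ℂ` with `closedBall p ρ ⊆ e.source` (`ρ > 0`) and
`‖e p‖ = 1`, and let `f M` be continuous on `closedBall p ρ` with `f M = 1 + e^M + o(1)` uniformly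
on the ball as `M → ∞`.  Then for every large `M` the function `f M` has a zero in `closedBall p ρ`. -/
theorem exists_zero_of_twoLevel (e : OpenPartialHomeomorph (ℝ × ℝ) ℂ) (p : ℝ × ℝ) (ρ : ℝ)
    (f : ℕ → ℝ × ℝ → ℂ) (hρ : 0 < ρ) (hsrc : closedBall p ρ ⊆ e.source) (hnorm : ‖e p‖ = 1)
    (hcont : ∀ M : ℕ, ContinuousOn (f M) (closedBall p ρ))
    (happrox : ∀ δ : ℝ, 0 < δ → ∃ M₁ : ℕ, ∀ M : ℕ, M₁ ≤ M → ∀ q ∈ closedBall p ρ,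
      ‖f M q - 1 - (e q) ^ M‖ ≤ δ) :
    ∃ M₀ : ℕ, ∀ M : ℕ, M₀ ≤ M → ∃ q ∈ closedBall p ρ, f M q = 0 := by
  -- a closed disc around `e p` inside the (open) image of the open ball
  have hp : p ∈ e.source := hsrc (mem_closedBall_self hρ.le)
  have himg : e '' ball p ρ ∈ nhds (e p) := e.image_mem_nhds hp (ball_mem_nhds p hρ)
  obtain ⟨ε, hε, hεsub⟩ := Metric.mem_nhds_iff.1 himg
  obtain ⟨η, hη0, hη1, hηε⟩ : ∃ η : ℝ, 0 < η ∧ η ≤ 1 ∧ η < ε :=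
    ⟨min (ε / 2) 1, lt_min (half_pos hε) one_pos, min_le_right _ _,
      (min_le_left _ _).trans_lt (half_lt_self hε)⟩
  have hηsub : closedBall (e p) η ⊆ e '' ball p ρ := (closedBall_subset_ball hηε).trans hεsub
  -- uniform approximation to within `1/2`, and `M` large enough for the root selection
  obtain ⟨M₁, hM₁⟩ := happrox (1 / 2) one_half_pos
  obtain ⟨M₂, hM₂⟩ := exists_nat_ge (2 * (π + 1) / η)
  refine ⟨max M₁ M₂, fun M hM => ?_⟩
  have hMM₁ : M₁ ≤ M := le_of_max_le_left hM
  have hMreal : 2 * (π + 1) / η ≤ (M : ℝ) := hM₂.trans (Nat.cast_le.mpr (le_of_max_le_right hM))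
  have hMpos : (0 : ℝ) < M := lt_of_lt_of_le (div_pos (by positivity) hη0) hMreal
  have hMη : 2 * ((π + 1) / (M : ℝ)) ≤ η := by
    have h1 : 2 * (π + 1) ≤ (M : ℝ) * η := by
      have h := mul_le_mul_of_nonneg_right hMreal hη0.le
      rwa [div_mul_cancel₀ _ hη0.ne'] at h
    rw [← mul_div_assoc, div_le_iff₀ hMpos]
    linarith
  exact exists_zero_of_twoLevel_fixed e p (f M) hρ.le hsrc hnorm hη1 hηsub (hcont M) (hM₁ M hMM₁)
    hMpos hMη

/-- S3 (registered stub): the planar two-level zero lemma.  If `f M = 1 + e^M + o(1)` uniformly on a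
closed ball around `p` on which `e` is a local homeomorphism with `‖e p‖ = 1`, then `f M` has a zero
in the ball for every large `M`. -/
theorem stub_twoLevelZeroLemma :
    ∀ (e : OpenPartialHomeomorph (ℝ × ℝ) ℂ) (p : ℝ × ℝ) (ρ : ℝ) (f : ℕ → ℝ × ℝ → ℂ),
      0 < ρ → closedBall p ρ ⊆ e.source → ‖e p‖ = 1 →
      (∀ M : ℕ, ContinuousOn (f M) (closedBall p ρ)) →
      (∀ δ : ℝ, 0 < δ → ∃ M₁ : ℕ, ∀ M : ℕ, M₁ ≤ M → ∀ q ∈ closedBall p ρ, ‖f M q - 1 - (e q) ^ M‖ ≤ δ) →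
      ∃ M₀ : ℕ, ∀ M : ℕ, M₀ ≤ M → ∃ q ∈ closedBall p ρ, f M q = 0 :=
  exists_zero_of_twoLevel

end Summit.HubbardSuperconductivity.BirComplexStableXYNegative
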